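import Summits.QuantumAdvantage.QuantumAdvantage.Theorems.LinnikCubicClassGroupsDegreeOnePrimesEscapeClassPNTDHNumerics
import HarnessLib

/-!
# The class prime number theorem with DECAYING error, I: real-variable bookkeeping

Topic `Summits/QuantumAdvantage/QuantumAdvantage/Theorems`, cell B2b-1 (linnik-cubic), PART A (gen 32);
helper toward the crux `DegreeOnePrimesEscape` (stmt-QuantumAdvantage-11543) of route
`LinnikCubicClassGroups`.  HONEST FRAMING: the value of this file is a THEOREM (kernel-checked) — NOT
summit progress (the route still rests on the hypothesis-type target `PureCubicClassNumberHard`).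

Sequel of `…ClassPNTDHNumerics.lean`.  There the density-times-repulsion bound
`A₀ (e^{−c_Z L/(4a log Q)} + e^{−√(c_Z L/4)})` and the junk terms were absorbed into `η · x` for a FIXED
`η > 0` at the price of a threshold `x ≥ Q^{a₁(η)}`.  Here the `x`-dependence is kept: every term is
bounded by a multiple of the Thorner–Zaman DECAY SHAPE

  `𝓓_κ(x) = e^{−κ log x / log Q} + e^{−√(κ log x)}`            (`κ > 0` depending on the degree only)

times, in the Deuring–Heilbronn regime, the relative size `η₁ = (1 − β₁) log x` of the main term — the
bookkeeping of [ThornerZaman2019, §5, proof of Thm. 5.1] ("`ψ_C(x) = (|C|/|G|) g(x) (1 + O(e^{−c log x/log Q}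
+ e^{−(c log x)^{1/2}/n_K^{1/2}}))`").  Pure real-variable lemmas:

* `decayShape_mono` — `𝓓_κ ≤ 𝓓_{κ'}` for `κ' ≤ κ`;
* `zeroSum_classical_decay` — with the classical zero-free constant `c`:
  `e^{−cL/(4a log Q)} + e^{−√(cL/4)} ≤ 𝓓_κ` for `κ ≤ c/(4a)`;
* `junk_decay`, `rpow_one_sub_decay`, `unsmoothing_decay` — the trivial-zero/left-line/tail terms, the
  powers `x^{1−ν}` and the unsmoothing error are `≤ const · x e^{−(ν/2) L} · c₁Q^{−2}` (resp. `ν/4`), hence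
  below BOTH `x 𝓓_κ` and `x 𝓓_κ · (1 − β₁) log x` (Stark: `(1 − β₁) ≥ c₁ Q^{−2}`);
* (sequel `…ClassPNTDecayNumericsDH.lean`: the Deuring–Heilbronn regime.)

Reference: J. Thorner, A. Zaman, *A unified and improved Chebotarev density theorem*, Algebra Number
Theory 13 (2019), §5 [ThornerZaman2019].
-/

noncomputable section

open Real

namespace Summit.QuantumAdvantage.QuantumAdvantage.Theorems.DegreeOnePrimesEscape

/-! ### The decay shape -/

/-- **Monotonicity of the decay shape in `κ`**: for `L ≥ 0`, `lQ > 0` and `κ' ≤ κ`,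
`e^{−κL/lQ} + e^{−√(κL)} ≤ e^{−κ'L/lQ} + e^{−√(κ'L)}`. [folklore] -/
theorem decayShape_mono {κ κ' L lQ : ℝ} (hL : 0 ≤ L) (hlQ : 0 < lQ) (hκ : κ' ≤ κ) :
    Real.exp (-(κ * L / lQ)) + Real.exp (-Real.sqrt (κ * L)) ≤
      Real.exp (-(κ' * L / lQ)) + Real.exp (-Real.sqrt (κ' * L)) := by
  refine add_le_add ?_ ?_
  · rw [Real.exp_le_exp, neg_le_neg_iff]
    exact div_le_div_of_nonneg_right (mul_le_mul_of_nonneg_right hκ hL) hlQ.le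
  · rw [Real.exp_le_exp, neg_le_neg_iff]
    exact Real.sqrt_le_sqrt (mul_le_mul_of_nonneg_right hκ hL)

/-- `e^{−κL} ≤ e^{−κL/lQ}` for `lQ ≥ 1`, `κ ≥ 0`, `L ≥ 0`. [folklore] -/
theorem exp_neg_mul_le_exp_neg_div {κ L lQ : ℝ} (hκ : 0 ≤ κ) (hL : 0 ≤ L) (hlQ : 1 ≤ lQ) :
    Real.exp (-(κ * L)) ≤ Real.exp (-(κ * L / lQ)) := by
  rw [Real.exp_le_exp, neg_le_neg_iff, div_le_iff₀ (by linarith)]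
  have : κ * L * 1 ≤ κ * L * lQ := mul_le_mul_of_nonneg_left hlQ (mul_nonneg hκ hL)
  linarith

/-- `e^{−κL} ≤ 𝓓_κ` (`lQ ≥ 1`, `κ, L ≥ 0`). [folklore] -/
theorem exp_neg_mul_le_decayShape {κ L lQ : ℝ} (hκ : 0 ≤ κ) (hL : 0 ≤ L) (hlQ : 1 ≤ lQ) :
    Real.exp (-(κ * L)) ≤ Real.exp (-(κ * L / lQ)) + Real.exp (-Real.sqrt (κ * L)) :=
  (exp_neg_mul_le_exp_neg_div hκ hL hlQ).trans (le_add_of_nonneg_right (Real.exp_pos _).le)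

/-- **The classical zero-sum bound is below the decay shape**: for `κ ≤ c/(4a)`, `a ≥ 1`, `c ≥ 0`,
`L ≥ 0`, `lQ > 0`: `e^{−cL/(4a lQ)} + e^{−√(cL/4)} ≤ e^{−κL/lQ} + e^{−√(κL)}`. [folklore] -/
theorem zeroSum_classical_decay {c a κ L lQ : ℝ} (hc : 0 ≤ c) (ha : 1 ≤ a) (hL : 0 ≤ L) (hlQ : 0 < lQ)
    (hκ : κ ≤ c / (4 * a)) :
    Real.exp (-(c * L / (4 * a * lQ))) + Real.exp (-Real.sqrt (c * L / 4)) ≤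
      Real.exp (-(κ * L / lQ)) + Real.exp (-Real.sqrt (κ * L)) := by
  have ha0 : 0 < a := by linarith
  have hκ' : κ ≤ c / 4 :=
    hκ.trans (div_le_div_of_nonneg_left hc (by norm_num) (by nlinarith))
  refine add_le_add ?_ ?_
  · rw [Real.exp_le_exp, neg_le_neg_iff]
    rw [show c * L / (4 * a * lQ) = c / (4 * a) * L / lQ by field_simp]
    exact div_le_div_of_nonneg_right (mul_le_mul_of_nonneg_right hκ hL) hlQ.le
  · rw [Real.exp_le_exp, neg_le_neg_iff]
    refine Real.sqrt_le_sqrt ?_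
    rw [show c * L / 4 = c / 4 * L by ring]
    exact mul_le_mul_of_nonneg_right hκ' hL

/-! ### The junk terms -/

/-- **The powers `x^{1−ν}` decay**: for `Q ≥ 12`, `x ≥ Q^{a}`, `0 < ν ≤ 1/2`, `c₁ > 0` and
`a ≥ (8 + 4 max(0, log(1/c₁)))/ν`: `x^{1−ν} ≤ x · e^{−(ν/4) log x} · c₁ Q^{−2}`. [folklore] -/
theorem rpow_one_sub_decay {Q x ν c₁ a : ℝ} (hQ : 12 ≤ Q) (hx : Q ^ a ≤ x) (hν : 0 < ν) (hν2 : ν ≤ 1 / 2)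
    (hc₁ : 0 < c₁) (ha : (8 + 4 * max 0 (Real.log (1 / c₁))) / ν ≤ a) :
    x ^ (1 - ν) ≤ x * Real.exp (-(ν / 4 * Real.log x)) * (c₁ * Q ^ (-(2 : ℝ))) := by
  have hQ0 : 0 < Q := by linarith
  have hQ1 : (1 : ℝ) ≤ Q := by linarith
  have hm0 : 0 ≤ max 0 (Real.log (1 / c₁)) := le_max_left _ _
  have ha1 : (1 : ℝ) ≤ a := by
    have h16 : (16 : ℝ) ≤ (8 + 4 * max 0 (Real.log (1 / c₁))) / ν := by
      rw [le_div_iff₀ hν]; nlinarith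
    linarith
  have hxQ : Q ≤ x := by
    have := Real.rpow_le_rpow_of_exponent_le hQ1 ha1
    rw [Real.rpow_one] at this; exact this.trans hx
  have hx1 : (1 : ℝ) ≤ x := by linarith
  have hx0 : 0 < x := by linarith
  -- threshold: `(1/c₁) Q² x^{-ν/4} ≤ 1`
  have hth := mul_rpow_neg_le_one_of_threshold (k := 2) (M := 1 / c₁) (ν := ν / 4) hQ hx
    (by positivity) (by positivity) (by have := (div_le_iff₀ hν).1 ha; linarith)
  -- `x^{1-ν} ≤ x · x^{-ν/4} · x^{-ν/4}`
  have h1 : x ^ (1 - ν) ≤ x * x ^ (-(ν / 4)) * x ^ (-(ν / 4)) := by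
    rw [mul_assoc, ← Real.rpow_add hx0, ← Real.rpow_one_add' hx0.le (by linarith)]
    exact Real.rpow_le_rpow_of_exponent_le hx1 (by linarith)
  have h2 : x ^ (-(ν / 4)) = Real.exp (-(ν / 4 * Real.log x)) := by
    rw [Real.rpow_def_of_pos hx0]; ring_nf
  have hQ2 : Q ^ (2 : ℝ) * Q ^ (-(2 : ℝ)) = 1 := by rw [← Real.rpow_add hQ0]; norm_num
  have h3 : x ^ (-(ν / 4)) ≤ c₁ * Q ^ (-(2 : ℝ)) := by
    have hQm2 : 0 < Q ^ (-(2 : ℝ)) := Real.rpow_pos_of_pos hQ0 _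
    have := mul_le_mul_of_nonneg_left hth (by positivity : (0 : ℝ) ≤ c₁ * Q ^ (-(2 : ℝ)))
    rw [mul_one] at this
    refine le_trans (le_of_eq ?_) this
    calc x ^ (-(ν / 4)) = x ^ (-(ν / 4)) * (Q ^ (2 : ℝ) * Q ^ (-(2 : ℝ))) := by rw [hQ2, mul_one]
      _ = c₁ * Q ^ (-(2 : ℝ)) * (1 / c₁ * Q ^ (2 : ℝ) * x ^ (-(ν / 4))) := by field_simp
  calc x ^ (1 - ν) ≤ x * x ^ (-(ν / 4)) * x ^ (-(ν / 4)) := h1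
    _ ≤ x * x ^ (-(ν / 4)) * (c₁ * Q ^ (-(2 : ℝ))) :=
        mul_le_mul_of_nonneg_left h3 (by positivity)
    _ = x * Real.exp (-(ν / 4 * Real.log x)) * (c₁ * Q ^ (-(2 : ℝ))) := by rw [h2]

/-- **The trivial-zero, left-line and tail terms decay**: for `Q ≥ 12`, `x ≥ Q^{a₁}` (`a₁ ≥ 32`,
`a₁ ≥ (8 + 4 max(0, log(1/c₁)))/ν`), `0 < ν ≤ 1/64`, `h ≤ Q⁴`:
`A₀ x^{1−ν} + h (1152 e^{(log x)/4} + C_J) ≤ (A₀ + 1152 + C_J) · x e^{−(ν/4) log x} · c₁ Q^{−2}`. [folklore] -/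
theorem junk_decay {A₀ CJ h Q x ν c₁ a₁ : ℝ} (hA₀ : 0 < A₀) (hCJ : 0 ≤ CJ) (hQ : 12 ≤ Q)
    (hh : h ≤ Q ^ 4) (hν : 0 < ν) (hν1 : ν ≤ 1 / 64) (hc₁ : 0 < c₁)
    (hx : Q ^ a₁ ≤ x) (ha₁ : 32 ≤ a₁) (ha₁J : (8 + 4 * max 0 (Real.log (1 / c₁))) / ν ≤ a₁) :
    A₀ * x ^ (1 - ν) + h * (1152 * Real.exp (Real.log x / 4) + CJ) ≤
      (A₀ + 1152 + CJ) * (x * Real.exp (-(ν / 4 * Real.log x)) * (c₁ * Q ^ (-(2 : ℝ)))) := by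
  have hQ0 : 0 < Q := by linarith
  have hQ1 : (1 : ℝ) ≤ Q := by linarith
  have hxQ : Q ≤ x := by
    have := Real.rpow_le_rpow_of_exponent_le hQ1 (by linarith : (1 : ℝ) ≤ a₁)
    rw [Real.rpow_one] at this; exact this.trans hx
  have hx1 : (1 : ℝ) ≤ x := by linarith
  have hx0 : 0 < x := by linarith
  -- `h ≤ Q⁴ ≤ x^{1/8}`
  have hQ4 : Q ^ 4 ≤ x ^ ((1 : ℝ) / 8) := by
    have h1 : (Q ^ (4 : ℕ) : ℝ) = (Q ^ a₁) ^ ((4 : ℝ) / a₁) := by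
      rw [← Real.rpow_mul hQ0.le, mul_div_cancel₀ _ (by linarith : a₁ ≠ 0)]
      norm_cast
    rw [h1]
    calc (Q ^ a₁) ^ ((4 : ℝ) / a₁) ≤ x ^ ((4 : ℝ) / a₁) :=
          Real.rpow_le_rpow (Real.rpow_nonneg hQ0.le _) hx (by positivity)
      _ ≤ x ^ ((1 : ℝ) / 8) := by
          refine Real.rpow_le_rpow_of_exponent_le hx1 ?_
          rw [div_le_iff₀ (by linarith)]; linarith
  have hh' : h ≤ x ^ ((1 : ℝ) / 8) := hh.trans hQ4
  have hexp : Real.exp (Real.log x / 4) = x ^ ((1 : ℝ) / 4) := by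
    rw [Real.rpow_def_of_pos hx0]; ring_nf
  have hpow1 : x ^ ((1 : ℝ) / 8) * x ^ ((1 : ℝ) / 4) ≤ x ^ (1 - ν) := by
    rw [← Real.rpow_add hx0]
    exact Real.rpow_le_rpow_of_exponent_le hx1 (by linarith)
  have hpow2 : x ^ ((1 : ℝ) / 8) ≤ x ^ (1 - ν) := Real.rpow_le_rpow_of_exponent_le hx1 (by linarith)
  have hJ1 : h * (1152 * Real.exp (Real.log x / 4)) ≤ 1152 * x ^ (1 - ν) := by
    rw [hexp]
    calc h * (1152 * x ^ ((1 : ℝ) / 4)) ≤ x ^ ((1 : ℝ) / 8) * (1152 * x ^ ((1 : ℝ) / 4)) :=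
          mul_le_mul_of_nonneg_right hh' (by positivity)
      _ = 1152 * (x ^ ((1 : ℝ) / 8) * x ^ ((1 : ℝ) / 4)) := by ring
      _ ≤ 1152 * x ^ (1 - ν) := mul_le_mul_of_nonneg_left hpow1 (by norm_num)
  have hJ2 : h * CJ ≤ CJ * x ^ (1 - ν) := by
    calc h * CJ ≤ x ^ ((1 : ℝ) / 8) * CJ := mul_le_mul_of_nonneg_right hh' hCJ
      _ = CJ * x ^ ((1 : ℝ) / 8) := mul_comm _ _
      _ ≤ CJ * x ^ (1 - ν) := mul_le_mul_of_nonneg_left hpow2 hCJ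
  have hsum : A₀ * x ^ (1 - ν) + h * (1152 * Real.exp (Real.log x / 4) + CJ) ≤
      (A₀ + 1152 + CJ) * x ^ (1 - ν) := by
    rw [mul_add h]; nlinarith [hJ1, hJ2]
  have hdec := rpow_one_sub_decay (a := a₁) hQ hx hν (by linarith) hc₁ ha₁J
  exact hsum.trans (mul_le_mul_of_nonneg_left hdec (by positivity))

/-- **The unsmoothing error decays**: for `Q ≥ 12`, `0 ≤ h ≤ Q⁴`, `x ≥ Q^{a}`, `0 < ν ≤ 1/2`, `c₁ > 0`,
`a ≥ (24 + 4 max(0, log(88(n+1)/(ν c₁))))/ν`: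
`n h (log x + 1)(8√x + 2x^{−ν}x + 1) ≤ (x e^{−(ν/4) log x}) · c₁ Q^{−2}`. [folklore] -/
theorem unsmoothing_decay {n h Q x ν c₁ a : ℝ} (hn : 0 ≤ n) (hh0 : 0 ≤ h) (hh : h ≤ Q ^ 4) (hQ : 12 ≤ Q)
    (hν : 0 < ν) (hν2 : ν ≤ 1 / 2) (hc₁ : 0 < c₁) (hx : Q ^ a ≤ x)
    (ha : (24 + 4 * max 0 (Real.log (88 * (n + 1) / (ν * c₁)))) / ν ≤ a) :
    n * h * ((Real.log x + 1) * (8 * Real.sqrt x + 2 * x ^ (-ν) * x + 1)) ≤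
      x * Real.exp (-(ν / 4 * Real.log x)) * (c₁ * Q ^ (-(2 : ℝ))) := by
  have hQ0 : 0 < Q := by linarith
  have hQ1 : (1 : ℝ) ≤ Q := by linarith
  have hm0 : 0 ≤ max 0 (Real.log (88 * (n + 1) / (ν * c₁))) := le_max_left _ _
  have ha1 : (1 : ℝ) ≤ a := by
    have h48 : (48 : ℝ) ≤ (24 + 4 * max 0 (Real.log (88 * (n + 1) / (ν * c₁)))) / ν := by
      rw [le_div_iff₀ hν]; nlinarith
    linarith
  have hxQ : Q ≤ x := by
    have := Real.rpow_le_rpow_of_exponent_le hQ1 ha1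
    rw [Real.rpow_one] at this; exact this.trans hx
  have hx1 : (1 : ℝ) < x := by linarith
  have hx0 : 0 < x := by linarith
  set L := Real.log x with hL
  have hlog12 : (1 : ℝ) ≤ Real.log 12 := by
    rw [Real.le_log_iff_exp_le (by norm_num)]
    have := Real.exp_one_lt_d9; linarith
  have hL1 : 1 ≤ L := hlog12.trans (Real.log_le_log (by norm_num) (by linarith))
  -- the bracket is `≤ 11 x^{1-ν}` and `log x + 1 ≤ 2 log x`
  have hpow : x ^ (-ν) * x = x ^ (1 - ν) := by
    rw [sub_eq_add_neg, Real.rpow_add hx0, Real.rpow_one]; ring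
  have hsqrt : Real.sqrt x ≤ x ^ (1 - ν) := by
    rw [Real.sqrt_eq_rpow]
    exact Real.rpow_le_rpow_of_exponent_le hx1.le (by linarith)
  have hone : (1 : ℝ) ≤ x ^ (1 - ν) := Real.one_le_rpow hx1.le (by linarith)
  have hbr : 8 * Real.sqrt x + 2 * x ^ (-ν) * x + 1 ≤ 11 * x ^ (1 - ν) := by
    rw [mul_assoc, hpow]; linarith
  have hP0 : 0 ≤ x ^ (1 - ν) := Real.rpow_nonneg hx0.le _
  have h1 : n * h * ((L + 1) * (8 * Real.sqrt x + 2 * x ^ (-ν) * x + 1)) ≤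
      22 * n * h * L * x ^ (1 - ν) := by
    have := mul_le_mul (by linarith : L + 1 ≤ 2 * L) hbr (by positivity) (by linarith)
    have := mul_le_mul_of_nonneg_left this (mul_nonneg hn hh0)
    linarith
  -- `L ≤ (4/ν) x^{ν/4}`
  have hLle : L ≤ x ^ (ν / 4) / (ν / 4) := Real.log_le_rpow_div hx0.le (by positivity)
  have h2 : 22 * n * h * L * x ^ (1 - ν) ≤ 88 * (n + 1) / ν * Q ^ 4 * (x ^ (ν / 4) * x ^ (1 - ν)) := by
    have hA : n * h ≤ (n + 1) * Q ^ 4 := by nlinarith [mul_le_mul_of_nonneg_left hh hn, hQ0]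
    have hB : L * x ^ (1 - ν) ≤ x ^ (ν / 4) / (ν / 4) * x ^ (1 - ν) :=
      mul_le_mul_of_nonneg_right hLle hP0
    have hC : 0 ≤ L * x ^ (1 - ν) := by positivity
    calc 22 * n * h * L * x ^ (1 - ν) = 22 * (n * h) * (L * x ^ (1 - ν)) := by ring
      _ ≤ 22 * ((n + 1) * Q ^ 4) * (x ^ (ν / 4) / (ν / 4) * x ^ (1 - ν)) :=
          mul_le_mul (mul_le_mul_of_nonneg_left hA (by norm_num)) hB hC (by positivity)
      _ = 88 * (n + 1) / ν * Q ^ 4 * (x ^ (ν / 4) * x ^ (1 - ν)) := by field_simp; ring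
  -- `x^{ν/4} x^{1-ν} = x · x^{-ν/4} · x^{-ν/2}`
  have h3 : x ^ (ν / 4) * x ^ (1 - ν) = x * x ^ (-(ν / 4)) * x ^ (-(ν / 2)) := by
    rw [← Real.rpow_add hx0, mul_assoc, ← Real.rpow_add hx0, ← Real.rpow_one_add' hx0.le (by linarith)]
    ring_nf
  -- threshold: `(88(n+1)/(ν c₁)) Q⁶ x^{-ν/2} ≤ 1`
  have hth := mul_rpow_neg_le_one_of_threshold (k := 6) (M := 88 * (n + 1) / (ν * c₁)) (ν := ν / 2)
    hQ hx (by positivity) (by positivity) (by have := (div_le_iff₀ hν).1 ha; linarith)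
  have hQ62 : Q ^ (6 : ℝ) * Q ^ (-(2 : ℝ)) = Q ^ 4 := by
    rw [← Real.rpow_add hQ0]; norm_num
  have h4 : 88 * (n + 1) / ν * Q ^ 4 * x ^ (-(ν / 2)) ≤ c₁ * Q ^ (-(2 : ℝ)) := by
    have hQm2 : 0 < Q ^ (-(2 : ℝ)) := Real.rpow_pos_of_pos hQ0 _
    have := mul_le_mul_of_nonneg_left hth (by positivity : (0 : ℝ) ≤ c₁ * Q ^ (-(2 : ℝ)))
    rw [mul_one] at this
    refine le_trans (le_of_eq ?_) this
    rw [← hQ62]; field_simp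
  have h5 : x ^ (-(ν / 4)) = Real.exp (-(ν / 4 * L)) := by
    rw [Real.rpow_def_of_pos hx0, ← hL]; ring_nf
  calc n * h * ((L + 1) * (8 * Real.sqrt x + 2 * x ^ (-ν) * x + 1))
      ≤ 22 * n * h * L * x ^ (1 - ν) := h1
    _ ≤ 88 * (n + 1) / ν * Q ^ 4 * (x ^ (ν / 4) * x ^ (1 - ν)) := h2
    _ = x * x ^ (-(ν / 4)) * (88 * (n + 1) / ν * Q ^ 4 * x ^ (-(ν / 2))) := by rw [h3]; ring
    _ ≤ x * x ^ (-(ν / 4)) * (c₁ * Q ^ (-(2 : ℝ))) := mul_le_mul_of_nonneg_left h4 (by positivity)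
    _ = x * Real.exp (-(ν / 4 * L)) * (c₁ * Q ^ (-(2 : ℝ))) := by rw [h5]

end Summit.QuantumAdvantage.QuantumAdvantage.Theorems.DegreeOnePrimesEscape

end
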